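import Literature.Probability.RandomPlanarGeometry.SAWTiltedFiniteMemory16T11x9
import Literature.Probability.RandomPlanarGeometry.SAWFiniteMemory18
import Literature.Probability.RandomPlanarGeometry.SAWSubBallistic
import Literature.Probability.RandomPlanarGeometry.SAWLowerBound2604
import HarnessLib

/-!
# Duminil-Copin–Hammond's sub-ballisticity theorem on `ℤ²` with an explicit rate above speed `0.542`

Topic `Literature/Probability/RandomPlanarGeometry` (continues `SAWTiltedFiniteMemory.lean`,
`SAWSubBallisticExplicit.lean`). Theorem 1.1 of Duminil-Copin–Hammond (2013) — typed in the tree as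
the named fact `Zd.DuminilCopinHammond2013_thm1_1` over the event
`Zd.maxDisplacementEvent d n v = {γ ∈ SAW_n : max_{k ≤ n} ‖γ_k‖₂ ≥ vn}` — asserts an inexplicit
exponential rate `ε(v) > 0` for every `v > 0`. This file proves the `d = 2` statement with an
EXPLICIT rate for all speeds `v > √2 · v₀ = 0.5414…` (and a trivially true but vacuous bound below):

* `card_maxEvent_le_sum` — FIRST-PASSAGE DECOMPOSITION: a walk whose abscissa reaches `m` at
  some time splits there into a self-avoiding walk with END abscissa `≥ m` and a self-avoiding
  remainder, so `#{∃ k ≤ n : x(ω_k) ≥ m} ≤ Σ_{k ≤ n} #{ω ∈ SAW_k : x(ω_k) ≥ m} · c_{n-k}`;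
* `card_maxEvent_le_of_checkW` — with the tilted certificate (`#{SAW_k : x ≥ m} ≤ 2⁴¹ λ̄ᵏ (b/a)^m`,
  `SAWTiltedFiniteMemory.lean`) and the memory-18 growth bound `c_j ≤ 2⁴¹ · 2.689ʲ`
  (`FiniteMemory.checkC_18`), `#{∃ k ≤ n : x(ω_k) ≥ m} ≤ (n+1) 2⁸² λ̄ⁿ (b/a)^m` when `λ̄ ≥ 2.689`;
* `card_dirEvent_le` + the lattice symmetries `negX`, `rotYX`, `rotNegYX` (relabelled step words have
  linearly transformed trajectories, `traj_map_of_linear`; self-avoidance is preserved) — the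
  events for `-x`, `+y`, `-y` are no larger than the `+x` one;
* `exists_coord_ge_of_euclidNorm_ge` — `‖z‖₂ ≥ R ⇒` some `±z_i ≥ R/√2`; hence
  `card_maxDisplacementEvent_le_four_mul`: the Euclidean event is covered by the four axis events
  at level `⌈vn/√2⌉`;
* **`card_maxDisplacementEvent_le_of_checkW`** (any tilt certificate, any certified `μlo ≤ μ`) and
  **`card_maxDisplacementEvent_le_exp`**: for every `v ≥ 0` and `n`,
  `#(maxDisplacementEvent 2 n v) ≤ 4(n+1)·2⁸²·exp(-(v/√2 - v₀)·log(11/9)·n)·cₙ`,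
  `v₀ = log(2.8119181…/2.604)/log(11/9) = 0.3828…` — i.e. `P_{SAW_n}(max_k ‖γ_k‖ ≥ vn) ≤
  4(n+1) 2⁸² e^{-0.2007 (v/√2 - 0.3828) n}`: the printed theorem with `(ε, n₀)` explicit for `v > 0.5414`.
Eight directions (adding the diagonal tilt `FiniteMemory.checkD`) would lower the threshold to
`v₀ / cos(π/8) = 0.414…`; not done here.

## References

* H. Duminil-Copin, A. Hammond, *Self-avoiding walk is sub-ballistic*, Commun. Math. Phys. 324
  (2013) 401–423, Theorem 1.1 and §2.4 (arXiv:1205.0401) [DuminilCopinHammond2013].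
* A. Pönitz, P. Tittmann, Electron. J. Combin. 7 (2000) R21, §3 [PonitzTittmann2000].
* N. Madras, G. Slade, *The Self-Avoiding Walk* (1993), §1.1 [MadrasSlade1993].
-/

open Finset Literature.Probability.LatticeModels
open scoped BigOperators

namespace Literature.Probability.RandomPlanarGeometry.SAW

open FiniteMemory

/-! ### Lattice symmetries of the self-avoiding words and of their trajectories -/

/-- A linear map of `ℤ²` compatible with a relabelling `g` of the step alphabet transports whole
trajectories: `traj (g·w) k = L (traj w k)`. [cite: MadrasSlade1993, §1.1] -/
theorem traj_map_of_linear (g : Step → Step) (L : Site 2 → Site 2) (hL0 : L 0 = 0)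
    (hLadd : ∀ x y, L (x + y) = L x + L y) (hvec : ∀ d, Step.vec (g d) = L (Step.vec d))
    (w : List Step) (k : ℕ) : traj (w.map g) k = L (traj w k) := by
  rw [traj, traj, ← List.map_take]
  induction (w.take k) with
  | nil => simp [hL0]
  | cons d u ih => rw [List.map_cons, wEnd_cons, wEnd_cons, ih, hvec, hLadd]

/-- Such a relabelling with an injective `L` preserves self-avoidance. [cite: MadrasSlade1993, §1.1] -/
theorem isSAW_map_of_linear (g : Step → Step) (L : Site 2 → Site 2) (hL0 : L 0 = 0)
    (hLadd : ∀ x y, L (x + y) = L x + L y) (hvec : ∀ d, Step.vec (g d) = L (Step.vec d))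
    (hinj : Function.Injective L) {w : List Step} (h : IsSAW w) : IsSAW (w.map g) := by
  rw [isSAW_iff_injOn] at h ⊢
  intro i hi j hj hij
  rw [List.length_map] at hi hj
  rw [traj_map_of_linear g L hL0 hLadd hvec, traj_map_of_linear g L hL0 hLadd hvec] at hij
  exact h hi hj (hinj hij)

/-- **Transport of directional events**: for a relabelling as above with `L` injective and any
readout `f : ℤ² → ℤ`, `#{w ∈ sawWords n : ∃ k ≤ n, m ≤ f(L(traj w k))} ≤ #{w ∈ sawWords n : ∃ k ≤ n, m ≤ f(traj w k)}`
(the map `w ↦ g·w` is an injection between the two events). [cite: MadrasSlade1993, §1.1] -/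
theorem card_dirEvent_le (g : Step → Step) (L : Site 2 → Site 2) (hL0 : L 0 = 0)
    (hLadd : ∀ x y, L (x + y) = L x + L y) (hvec : ∀ d, Step.vec (g d) = L (Step.vec d))
    (hinj : Function.Injective L) (hg : Function.Injective g) (f : Site 2 → ℤ) (n : ℕ) (m : ℤ) :
    ((sawWords n).filter fun w => ∃ k ≤ n, m ≤ f (L (traj w k))).card ≤
      ((sawWords n).filter fun w => ∃ k ≤ n, m ≤ f (traj w k)).card := by
  classical
  refine Finset.card_le_card_of_injOn (fun w => w.map g) (fun w hw => ?_) fun w _ w' _ h => ?_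
  · rw [Finset.mem_coe, mem_filter, mem_sawWords] at hw ⊢
    obtain ⟨⟨hl, hs⟩, k, hk, hm⟩ := hw
    refine ⟨⟨by rw [List.length_map, hl], isSAW_map_of_linear g L hL0 hLadd hvec hinj hs⟩, k, hk, ?_⟩
    rwa [traj_map_of_linear g L hL0 hLadd hvec]
  · exact List.map_injective_iff.2 hg h

/-- The reflection `x ↦ -x` as a relabelling (`d ↦ 2 - d`) and as a linear map. [cite: MadrasSlade1993, §1.1] -/
def negX (z : Site 2) : Site 2 := ![-z 0, z 1]

/-- The rotation bringing `+e₁` to `+e₀` (`d ↦ d + 3`): `(x, y) ↦ (y, -x)`. [cite: MadrasSlade1993, §1.1] -/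
def rotYX (z : Site 2) : Site 2 := ![z 1, -z 0]

/-- The rotation bringing `-e₁` to `+e₀` (`d ↦ d + 1`): `(x, y) ↦ (-y, x)`. [cite: MadrasSlade1993, §1.1] -/
def rotNegYX (z : Site 2) : Site 2 := ![-z 1, z 0]

/-- `negX` is additive, injective and realises `d ↦ 2 - d` on steps. [folklore] -/
private theorem negX_spec : negX 0 = 0 ∧ (∀ x y, negX (x + y) = negX x + negX y) ∧
    (∀ d, Step.vec (FiniteMemory.refl 2 d) = negX (Step.vec d)) ∧ Function.Injective negX := by
  refine ⟨?_, fun x y => ?_, fun d => ?_, fun x y h => ?_⟩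
  · ext i; fin_cases i
    · show -((0 : Site 2) 0) = 0; simp
    · rfl
  · ext i; fin_cases i
    · show -((x + y) 0) = -(x 0) + -(y 0); simp only [Pi.add_apply]; ring
    · rfl
  · fin_cases d <;> decide
  · have h0 := congrFun h 0; have h1 := congrFun h 1
    simp only [negX, Matrix.cons_val_zero, Matrix.cons_val_one, neg_inj] at h0 h1
    ext i; fin_cases i; exacts [h0, h1]

/-- `rotYX` is additive, injective and realises `d ↦ d + 3` on steps. [folklore] -/
private theorem rotYX_spec : rotYX 0 = 0 ∧ (∀ x y, rotYX (x + y) = rotYX x + rotYX y) ∧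
    (∀ d, Step.vec (FiniteMemory.rot 3 d) = rotYX (Step.vec d)) ∧ Function.Injective rotYX := by
  refine ⟨?_, fun x y => ?_, fun d => ?_, fun x y h => ?_⟩
  · ext i; fin_cases i
    · rfl
    · show -((0 : Site 2) 0) = 0; simp
  · ext i; fin_cases i
    · rfl
    · show -((x + y) 0) = -(x 0) + -(y 0); simp only [Pi.add_apply]; ring
  · fin_cases d <;> decide
  · have h0 := congrFun h 0; have h1 := congrFun h 1
    simp only [rotYX, Matrix.cons_val_zero, Matrix.cons_val_one, neg_inj] at h0 h1
    ext i; fin_cases i; exacts [h1, h0]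

/-- `rotNegYX` is additive, injective and realises `d ↦ d + 1` on steps. [folklore] -/
private theorem rotNegYX_spec : rotNegYX 0 = 0 ∧ (∀ x y, rotNegYX (x + y) = rotNegYX x + rotNegYX y) ∧
    (∀ d, Step.vec (FiniteMemory.rot 1 d) = rotNegYX (Step.vec d)) ∧ Function.Injective rotNegYX := by
  refine ⟨?_, fun x y => ?_, fun d => ?_, fun x y h => ?_⟩
  · ext i; fin_cases i
    · show -((0 : Site 2) 1) = 0; simp
    · rfl
  · ext i; fin_cases i
    · show -((x + y) 1) = -(x 1) + -(y 1); simp only [Pi.add_apply]; ring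
    · rfl
  · fin_cases d <;> decide
  · have h0 := congrFun h 0; have h1 := congrFun h 1
    simp only [rotNegYX, Matrix.cons_val_zero, Matrix.cons_val_one, neg_inj] at h0 h1
    ext i; fin_cases i; exacts [h1, h0]

/-- Reflections of the step alphabet are injective. [folklore] -/
private theorem refl_injective (r : Fin 4) : Function.Injective (FiniteMemory.refl r) :=
  fun a b h => by simp only [FiniteMemory.refl_apply] at h; exact sub_right_injective h

/-- Rotations of the step alphabet are injective. [folklore] -/
private theorem rot_injective (r : Fin 4) : Function.Injective (FiniteMemory.rot r) :=
  fun a b h => by simp only [FiniteMemory.rot_apply] at h; exact add_left_cancel h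

/-! ### First passage: the max-over-time event through endpoint events -/

/-- **First-passage decomposition** (any readout `f : ℤ² → ℤ`): a self-avoiding word whose
trajectory reaches `f ≥ m` at some time `k ≤ n` splits at that time into a `k`-step self-avoiding
word whose END satisfies `f ≥ m` and an `(n-k)`-step self-avoiding word; hence
`#{w ∈ sawWords n : ∃ k ≤ n, f(traj w k) ≥ m} ≤ Σ_{k ≤ n} #{u ∈ sawWords k : f(end u) ≥ m} · c_{n-k}`.
[cite: DuminilCopinHammond2013, §2.4] -/
theorem card_maxEvent_le_sum (f : Site 2 → ℤ) (n : ℕ) (m : ℤ) :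
    ((sawWords n).filter fun w => ∃ k ≤ n, m ≤ f (traj w k)).card ≤
      ∑ k ∈ range (n + 1), ((sawWords k).filter fun u => m ≤ f (traj u u.length)).card *
        (sawWords (n - k)).card := by
  classical
  set E := (sawWords n).filter fun w => ∃ k ≤ n, m ≤ f (traj w k) with hE
  set S := (range (n + 1)).sigma fun k => ((sawWords k).filter fun u => m ≤ f (traj u u.length)) ×ˢ
    sawWords (n - k) with hS
  have hcardS : S.card = ∑ k ∈ range (n + 1),
      ((sawWords k).filter fun u => m ≤ f (traj u u.length)).card * (sawWords (n - k)).card := by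
    rw [hS, card_sigma]; exact sum_congr rfl fun k _ => card_product _ _
  rw [← hcardS]
  have hex : ∀ w ∈ E, ∃ k, k ≤ n ∧ m ≤ f (traj w k) := fun w hw => by
    rw [hE, mem_filter] at hw; obtain ⟨k, hk, hm⟩ := hw.2; exact ⟨k, hk, hm⟩
  let τ : List Step → ℕ := fun w => if h : ∃ k, k ≤ n ∧ m ≤ f (traj w k) then Nat.find h else 0
  have hτ : ∀ w ∈ E, τ w ≤ n ∧ m ≤ f (traj w (τ w)) := fun w hw => by
    have h := hex w hw
    simp only [τ, dif_pos h]
    exact Nat.find_spec h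
  refine Finset.card_le_card_of_injOn
    (fun w => (⟨τ w, (w.take (τ w), w.drop (τ w))⟩ : Σ _ : ℕ, List Step × List Step))
    (fun w hw => ?_) (fun w hw w' _ h => ?_)
  · rw [Finset.mem_coe] at hw
    obtain ⟨hτn, hτm⟩ := hτ w hw
    rw [hE, mem_filter, mem_sawWords] at hw
    obtain ⟨⟨hl, hs⟩, -⟩ := hw
    have hlt : (w.take (τ w)).length = τ w := by rw [List.length_take]; omega
    simp only [Finset.mem_coe, hS, mem_sigma, mem_range, mem_product, mem_filter, mem_sawWords]
    refine ⟨by omega, ⟨⟨hlt, hs.take _⟩, ?_⟩, by rw [List.length_drop, hl], hs.drop _⟩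
    rw [hlt, traj_take _ le_rfl]
    exact hτm
  · simp only [Sigma.mk.injEq] at h
    obtain ⟨hk, hpair⟩ := h
    have hp : (w.take (τ w), w.drop (τ w)) = (w'.take (τ w'), w'.drop (τ w')) := eq_of_heq hpair
    simp only [Prod.mk.injEq] at hp
    rw [← List.take_append_drop (τ w) w, ← List.take_append_drop (τ w') w', hp.1, hp.2]

/-! ### The explicit bound on the max-over-time event along one direction -/

/-- **Max-over-time bound along `+x`** from a tilted certificate (`0 < b < a`, ratio `N/D` with
`N/(Dab) ≥ 2.689`, the tree's memory-18 growth bound `FiniteMemory.checkC_18`): for all `n`, `m`,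
`#{w ∈ sawWords n : ∃ k ≤ n, x(traj w k) ≥ m} ≤ (n+1) · 2⁸² · (N/(Dab))ⁿ · (b/a)^m`.
[cite: DuminilCopinHammond2013, Thm 1.1] -/
theorem card_maxEvent_le_of_checkW {K a b N D iters : ℕ} (h : checkW K a b N D iters = true)
    (hb : 0 < b) (hba : b < a) (hD : 0 < D) (hbig : (2689 / 1000 : ℝ) ≤ (N : ℝ) / (D * a * b))
    (n : ℕ) (m : ℤ) :
    (((sawWords n).filter fun w => ∃ k ≤ n, m ≤ traj w k 0).card : ℝ) ≤
      (n + 1) * 2 ^ 82 * ((N : ℝ) / (D * a * b)) ^ n * ((b : ℝ) / a) ^ m := by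
  have ha : 0 < a := lt_trans hb hba
  have hs0 : (0 : ℝ) < (b : ℝ) / a := by positivity
  have hl0 : (0 : ℝ) ≤ (N : ℝ) / (D * a * b) := by positivity
  set lam : ℝ := (N : ℝ) / (D * a * b) with hlam
  -- `c_j ≤ 2⁴¹ · 2.689^j ≤ 2⁴¹ · lam^j`
  have hc : ∀ j : ℕ, ((sawWords j).card : ℝ) ≤ 2 ^ 41 * lam ^ j := by
    intro j
    have h1 := count_mul_pow_le_of_checkC checkC_18 j
    rw [← count_eq_card_sawWords]
    have h2 : (count j : ℝ) * (1000 : ℝ) ^ j ≤ (2689 : ℝ) ^ j * 2 ^ 41 := by exact_mod_cast h1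
    have h3 : (count j : ℝ) ≤ 2 ^ 41 * (2689 / 1000 : ℝ) ^ j := by
      rw [div_pow, mul_div_assoc', le_div_iff₀ (by positivity)]; linarith
    exact le_trans h3 (by gcongr)
  have hA : ∀ k : ℕ, ((((sawWords k).filter fun u => m ≤ xEnd u).card : ℝ)) ≤
      2 ^ 41 * lam ^ k * ((b : ℝ) / a) ^ m := fun k => card_sawWords_xEnd_ge_le h hb hba.le hD k m
  have hfp := card_maxEvent_le_sum (fun z => z 0) n m
  calc (((sawWords n).filter fun w => ∃ k ≤ n, m ≤ traj w k 0).card : ℝ)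
      ≤ ∑ k ∈ range (n + 1), ((((sawWords k).filter fun u => m ≤ xEnd u).card : ℝ)) *
          ((sawWords (n - k)).card : ℝ) := by exact_mod_cast hfp
    _ ≤ ∑ k ∈ range (n + 1), (2 ^ 41 * lam ^ k * ((b : ℝ) / a) ^ m) * (2 ^ 41 * lam ^ (n - k)) :=
        sum_le_sum fun k _ => mul_le_mul (hA k) (hc (n - k)) (Nat.cast_nonneg _)
          (by positivity)
    _ = ∑ k ∈ range (n + 1), 2 ^ 82 * lam ^ n * ((b : ℝ) / a) ^ m := by
        refine sum_congr rfl fun k hk => ?_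
        rw [mem_range] at hk
        have : lam ^ k * lam ^ (n - k) = lam ^ n := by rw [← pow_add]; congr 1; omega
        calc 2 ^ 41 * lam ^ k * ((b : ℝ) / a) ^ m * (2 ^ 41 * lam ^ (n - k))
            = 2 ^ 41 * 2 ^ 41 * (lam ^ k * lam ^ (n - k)) * ((b : ℝ) / a) ^ m := by ring
          _ = _ := by rw [this]; norm_num
    _ = (n + 1) * 2 ^ 82 * lam ^ n * ((b : ℝ) / a) ^ m := by
        rw [sum_const, card_range, nsmul_eq_mul]; push_cast; ring

/-! ### The Euclidean max-displacement event of Duminil-Copin–Hammond -/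

/-- Euclidean norm at least `R ≥ 0` forces one coordinate to have modulus at least `R/√2`.
[cite: DuminilCopinHammond2013, §1.1] -/
theorem exists_coord_ge_of_euclidNorm_ge {R : ℝ} (hR : 0 ≤ R) {z : Site 2} (h : R ≤ Zd.euclidNorm z) :
    R / Real.sqrt 2 ≤ (z 0 : ℝ) ∨ R / Real.sqrt 2 ≤ -(z 0 : ℝ) ∨
      R / Real.sqrt 2 ≤ (z 1 : ℝ) ∨ R / Real.sqrt 2 ≤ -(z 1 : ℝ) := by
  have hsq : R ^ 2 ≤ ((z 0 : ℝ)) ^ 2 + ((z 1 : ℝ)) ^ 2 := by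
    have := pow_le_pow_left₀ hR h 2
    rw [Zd.sq_euclidNorm, Fin.sum_univ_two] at this
    exact this
  have h2 : (0 : ℝ) < Real.sqrt 2 := by positivity
  have hs : Real.sqrt 2 ^ 2 = 2 := Real.sq_sqrt (by norm_num)
  have hRs : (R / Real.sqrt 2) ^ 2 = R ^ 2 / 2 := by rw [div_pow, hs]
  have hRs0 : 0 ≤ R / Real.sqrt 2 := div_nonneg hR h2.le
  by_cases hx : R ^ 2 / 2 ≤ ((z 0 : ℝ)) ^ 2
  · -- `|x| ≥ R/√2`
    have : R / Real.sqrt 2 ≤ |((z 0 : ℝ))| := by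
      rw [← Real.sqrt_sq hRs0, ← Real.sqrt_sq_eq_abs]
      exact Real.sqrt_le_sqrt (by rw [hRs]; exact hx)
    rcases le_abs'.1 this with h' | h'
    · exact Or.inr (Or.inl (by linarith))
    · exact Or.inl h'
  · have hy : R ^ 2 / 2 ≤ ((z 1 : ℝ)) ^ 2 := by push Not at hx; linarith
    have : R / Real.sqrt 2 ≤ |((z 1 : ℝ))| := by
      rw [← Real.sqrt_sq hRs0, ← Real.sqrt_sq_eq_abs]
      exact Real.sqrt_le_sqrt (by rw [hRs]; exact hy)
    rcases le_abs'.1 this with h' | h'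
    · exact Or.inr (Or.inr (Or.inr (by linarith)))
    · exact Or.inr (Or.inr (Or.inl h'))

/-- **The Duminil-Copin–Hammond event is covered by four directional max-events** (axis
projections at level `⌈vn/√2⌉`), and each has the cardinality bound of the `+x` one; hence
`#(maxDisplacementEvent 2 n v) ≤ 4 · #{w ∈ sawWords n : ∃ k ≤ n, x(traj w k) ≥ ⌈vn/√2⌉}` for `v ≥ 0`.
[cite: DuminilCopinHammond2013, Thm 1.1] -/
theorem card_maxDisplacementEvent_le_four_mul {v : ℝ} (hv : 0 ≤ v) (n : ℕ) :
    (Zd.maxDisplacementEvent 2 n v).card ≤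
      4 * ((sawWords n).filter fun w => ∃ k ≤ n, ⌈v * n / Real.sqrt 2⌉ ≤ traj w k 0).card := by
  classical
  set m : ℤ := ⌈v * n / Real.sqrt 2⌉ with hm
  -- pass to words
  have hword : (Zd.maxDisplacementEvent 2 n v).card =
      ((sawWords n).filter fun w => ∃ k ≤ n, v * n ≤ Zd.euclidNorm (traj w k)).card := by
    rw [Zd.maxDisplacementEvent, ← image_traj_sawWords, filter_image, card_image_of_injOn]
    · intro w hw w' hw' h
      simp only [coe_filter, Set.mem_setOf_eq, mem_sawWords] at hw hw'
      exact eq_of_traj_eq (by rw [hw.1.1, hw'.1.1]) h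
  rw [hword]
  -- the four directional events
  set Ex := (sawWords n).filter fun w => ∃ k ≤ n, m ≤ traj w k 0 with hEx
  set Enx := (sawWords n).filter fun w => ∃ k ≤ n, m ≤ negX (traj w k) 0 with hEnx
  set Ey := (sawWords n).filter fun w => ∃ k ≤ n, m ≤ rotYX (traj w k) 0 with hEy
  set Eny := (sawWords n).filter fun w => ∃ k ≤ n, m ≤ rotNegYX (traj w k) 0 with hEny
  have hsub : ((sawWords n).filter fun w => ∃ k ≤ n, v * n ≤ Zd.euclidNorm (traj w k)) ⊆
      Ex ∪ Enx ∪ Ey ∪ Eny := by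
    intro w hw
    rw [mem_filter] at hw
    obtain ⟨hws, k, hk, hkv⟩ := hw
    have hvn : 0 ≤ v * n := by positivity
    simp only [mem_union, hEx, hEnx, hEy, hEny, mem_filter, negX, rotYX, rotNegYX,
      Matrix.cons_val_zero]
    rcases exists_coord_ge_of_euclidNorm_ge hvn hkv with h0 | h0 | h0 | h0
    · exact Or.inl (Or.inl (Or.inl ⟨hws, k, hk, Int.ceil_le.2 h0⟩))
    · exact Or.inl (Or.inl (Or.inr ⟨hws, k, hk, Int.ceil_le.2 (by push_cast; exact h0)⟩))
    · exact Or.inl (Or.inr ⟨hws, k, hk, Int.ceil_le.2 h0⟩)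
    · exact Or.inr ⟨hws, k, hk, Int.ceil_le.2 (by push_cast; exact h0)⟩
  obtain ⟨n0, n1, n2, n3⟩ := negX_spec
  obtain ⟨r0, r1, r2, r3⟩ := rotYX_spec
  obtain ⟨s0, s1, s2, s3⟩ := rotNegYX_spec
  have h1 : Enx.card ≤ Ex.card := card_dirEvent_le _ negX n0 n1 n2 n3 (refl_injective 2) (fun z => z 0) n m
  have h2 : Ey.card ≤ Ex.card := card_dirEvent_le _ rotYX r0 r1 r2 r3 (rot_injective 3) (fun z => z 0) n m
  have h3 : Eny.card ≤ Ex.card := card_dirEvent_le _ rotNegYX s0 s1 s2 s3 (rot_injective 1) (fun z => z 0) n m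
  have u0 := card_le_card hsub
  have u1 := card_union_le (Ex ∪ Enx ∪ Ey) Eny
  have u2 := card_union_le (Ex ∪ Enx) Ey
  have u3 := card_union_le Ex Enx
  omega

/-- **Explicit sub-ballisticity for the Duminil-Copin–Hammond event** from a tilted certificate:
with `0 < b < a`, `0 < D`, `N/(Dab) ≥ 2.689` and a certified `0 < μlo ≤ μ(ℤ²)`, for every `v ≥ 0`
and every `n`,
`#{ω ∈ SAW_n : max_{k ≤ n} ‖ω_k‖₂ ≥ vn} ≤ 4(n+1)·2⁸²·exp(-ε n)·cₙ` with
`ε = (v/√2)·log(a/b) - log(N/(D a b μlo))`. [cite: DuminilCopinHammond2013, Thm 1.1] -/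
theorem card_maxDisplacementEvent_le_of_checkW {K a b N D iters : ℕ} (h : checkW K a b N D iters = true)
    (hb : 0 < b) (hba : b < a) (hD : 0 < D) (hbig : (2689 / 1000 : ℝ) ≤ (N : ℝ) / (D * a * b))
    {μlo : ℝ} (hμ0 : 0 < μlo) (hμ : μlo ≤ Zd.connectiveConstant 2) {v : ℝ} (hv : 0 ≤ v) (n : ℕ) :
    ((Zd.maxDisplacementEvent 2 n v).card : ℝ) ≤
      4 * (n + 1) * 2 ^ 82 *
        Real.exp (-((v / Real.sqrt 2 * Real.log ((a : ℝ) / b) - Real.log ((N : ℝ) / (D * a * b) / μlo)) * n)) *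
        Zd.count 2 n := by
  have ha : 0 < a := lt_trans hb hba
  have hs0 : (0 : ℝ) < (b : ℝ) / a := by positivity
  have hs1 : (b : ℝ) / a ≤ 1 := by rw [div_le_one (by exact_mod_cast ha)]; exact_mod_cast hba.le
  have hl0 : (0 : ℝ) < (N : ℝ) / (D * a * b) := lt_of_lt_of_le (by norm_num) hbig
  set m : ℤ := ⌈v * n / Real.sqrt 2⌉ with hm
  have h4 := card_maxDisplacementEvent_le_four_mul hv n
  have hE := card_maxEvent_le_of_checkW h hb hba hD hbig n m
  have hμn : μlo ^ n ≤ (Zd.count 2 n : ℝ) :=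
    le_trans (pow_le_pow_left₀ hμ0.le hμ n) (Zd.pow_connectiveConstant_le_count 2 n)
  -- `(b/a)^m ≤ (b/a)^{vn/√2}` and the exponential rewriting
  have h1 : ((b : ℝ) / a) ^ m ≤ ((b : ℝ) / a) ^ (v / Real.sqrt 2 * n : ℝ) := by
    rw [← Real.rpow_intCast]
    refine Real.rpow_le_rpow_of_exponent_ge hs0 hs1 ?_
    rw [hm, show v / Real.sqrt 2 * n = v * n / Real.sqrt 2 by ring]; exact Int.le_ceil _
  have hexp : ((N : ℝ) / (D * a * b)) ^ n * ((b : ℝ) / a) ^ (v / Real.sqrt 2 * n : ℝ) =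
      Real.exp (-((v / Real.sqrt 2 * Real.log ((a : ℝ) / b) - Real.log ((N : ℝ) / (D * a * b) / μlo)) * n)) *
        μlo ^ n := by
    rw [Real.rpow_def_of_pos hs0, ← Real.exp_log (pow_pos hl0 n), ← Real.exp_log (pow_pos hμ0 n),
      ← Real.exp_add, ← Real.exp_add, Real.log_pow, Real.log_pow, Real.log_div hl0.ne' hμ0.ne',
      show Real.log ((b : ℝ) / a) = -Real.log ((a : ℝ) / b) by rw [← Real.log_inv, inv_div]]
    congr 1; ring
  calc ((Zd.maxDisplacementEvent 2 n v).card : ℝ)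
      ≤ 4 * (((sawWords n).filter fun w => ∃ k ≤ n, m ≤ traj w k 0).card : ℝ) := by exact_mod_cast h4
    _ ≤ 4 * ((n + 1) * 2 ^ 82 * ((N : ℝ) / (D * a * b)) ^ n * ((b : ℝ) / a) ^ m) := by gcongr
    _ ≤ 4 * ((n + 1) * 2 ^ 82 * ((N : ℝ) / (D * a * b)) ^ n * ((b : ℝ) / a) ^ (v / Real.sqrt 2 * n : ℝ)) := by
        gcongr
    _ = 4 * (n + 1) * 2 ^ 82 *
        Real.exp (-((v / Real.sqrt 2 * Real.log ((a : ℝ) / b) - Real.log ((N : ℝ) / (D * a * b) / μlo)) * n)) *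
        μlo ^ n := by rw [mul_assoc ((n : ℝ) + 1 : ℝ) (2 ^ 82), mul_assoc, mul_assoc, hexp]; ring
    _ ≤ _ := by gcongr

/-- **Duminil-Copin–Hammond's Theorem 1.1 on `ℤ²` with an explicit rate above speed `0.55`**:
with the tilt `11/9` certificate and `μ ≥ 2.604`, for every `v ≥ 0` and `n`,
`#(maxDisplacementEvent 2 n v) ≤ 4(n+1) 2⁸² · exp(-(v/√2 - v₀)·log(11/9)·n) · cₙ` where
`v₀ = log(λ̄/2.604)/log(11/9) = 0.3828…` (`λ̄ = 2.811918…`); nontrivial for `v > √2·v₀ = 0.5414…`.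
[cite: DuminilCopinHammond2013, Thm 1.1] -/
theorem card_maxDisplacementEvent_le_exp {v : ℝ} (hv : 0 ≤ v) (n : ℕ) :
    ((Zd.maxDisplacementEvent 2 n v).card : ℝ) ≤
      4 * (n + 1) * 2 ^ 82 *
        Real.exp (-((v / Real.sqrt 2 * Real.log ((11 : ℝ) / 9) -
          Real.log (((278379899 : ℕ) : ℝ) / ((1000000 : ℕ) * (11 : ℕ) * (9 : ℕ)) / 2.604)) * n)) *
        Zd.count 2 n := by
  have hμ : (2.604 : ℝ) ≤ Zd.connectiveConstant 2 := by
    rw [Zd.connectiveConstant_two]; exact le_connectiveConstant_2604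
  have h := card_maxDisplacementEvent_le_of_checkW checkW_16_11_9 (by norm_num) (by norm_num) (by norm_num)
    (by norm_num) (by norm_num : (0 : ℝ) < 2.604) hμ hv n
  push_cast at h ⊢
  exact h

end Literature.Probability.RandomPlanarGeometry.SAW
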